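import Summits.ResolutionOfSingularities.ResolutionOfSingularities.Theorems.RadicialJungCleanModelsWeakEmbeddedLUDimLEThree
import Summits.ResolutionOfSingularities.ResolutionOfSingularities.Theorems.FrobeniusClosingSteerCompositeRankLUBelow
import Literature.AlgebraicGeometry.Resolution.RankOneReductionProofs
import Literature.AlgebraicGeometry.Resolution.AffineDomainDimension
import HarnessLib

/-!
# The RESIDUE SIDE of the rank-one reduction of `hMono_4` is print: weak embedded LU of `ν₂` on the residue model `φ(A) ≅ A/𝔭` (dimension `≤ 3`)

Route `RadicialJung`, crux `CleanModels` (stmt-ResolutionOfSingularities-15917), registered skeleton `Cruxes/CleanModels/Lines/Sketch.lean`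
rev 35 (sha16 de44649d8f729c3b), stub 7 `stub_cleanModelsDimGEFour`.  Explicit-unit seat `decomp-res-hand-2` g4 (structural hand); memo
`Cruxes/CleanModels/Lines/Sketch-memo-hand2-g4-stubs-5-7.md` §2, step (ii).  OURS; structural bookkeeping, counted 0; nothing here proves
resolution of singularities in characteristic `p`.

Novacoski–Spivakovsky's reduction of WEAK EMBEDDED local uniformization to rank one (arXiv:1204.4751, Thm. 1.2, §3.2) applies, for
`ν = ν₁ ∘ ν₂` (`O ≤ O₁ ≠ K`), weak embedded LU to `ν₂` on the HOMOMORPHIC IMAGE `R/𝔭` of the model (`𝔭` the centre of `ν₁`), to monomialize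
the residues of finitely many units.  In the shape in which the tree's ✓ `novacoskiSpivakovsky2014_cor217` (Cor. 2.17, the lift back to
`R`) CONSUMES its residue-side hypothesis `h₂` — a field `κ` with `ι : κ → κ(O₁)`, the residue map `φ : A → κ` with `Frac φ(A) = κ`, the
valuation ring `(residueValuationSubring O O₁).comap ι` of `ν₂` on `κ` — this file PROVES that hypothesis, WITH MONOMIAL DATA, whenever
`dim A ≤ 4`: then `trdeg_k κ ≤ 3` (✓ `SteerRankThinness.trdeg_residueField_lt`, `𝔭 ≠ 0` as `O₁ ≠ K`), so `dim φ(A) ≤ 3` and hand-2 g4's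
✓ `weakEmbeddedLU_dimLEThree_of_cossartPiltant2019` (F-02 + F-32, ARBITRARY models — `φ(A) ≅ A/𝔭` is singular in general) applies.

* `weakEmbeddedLU_residueSide_dimLEFour` — the statement just described.

With ✓ `weakEmbeddedLU_along_properCoarsening_dimLEFour` (step (i)) this makes BOTH valuation-theoretic inputs of NS §3.2 PRINT in
transcendence degree `4`; what remains for «`hMono_4` at composite valuations» is the algebraic combination (Cor. 2.17 with monomial data +
Lemmas 2.18/2.19 + (21)–(24)), a port over `Literature/…/RankOneReductionProofs.lean`.
[cite: NovacoskiSpivakovsky2014, Thm. 1.2, Cor. 2.17, §3.2] [cite: CossartPiltant2019, Thm. 1.1] [cite: CossartJannsenSaito2020, Cor. 1.5]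
-/

noncomputable section

set_option linter.dupNamespace false -- mandated namespace of this single-conjunct summit

open IsLocalRing AlgebraicGeometry CategoryTheory
open Literature.AlgebraicGeometry.Resolution Literature.AlgebraicGeometry.Motives
open Summit.ResolutionOfSingularities.ResolutionOfSingularities.Theorems.SteerRankThinness

namespace Summit.ResolutionOfSingularities.ResolutionOfSingularities.Theorems.RadicialJung.CleanModels

variable {k K : Type} [Field k] [Field K] [Algebra k K]

/-- **The residue side of NS §3.2 is print in transcendence degree `4`** (see the module docstring): for `O ≤ O₁ ≠ K`, a finitely generated
model `A ⊆ O` with `Frac A = K` and `dim A ≤ 4`, a residue presentation `φ : A → κ`, `ι : κ → κ(O₁)` with `Frac φ(A) = κ`, and a finite set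
`W ⊆ φ(A)`: some finitely generated `φ(A) ≤ B ⊆ κ` inside the valuation ring of `ν₂` is regular at the centre of `ν₂`, with a regular system of
parameters in which every non-zero `w ∈ W` is a unit times a monomial — modulo F-02 (`CossartPiltant2019`) and F-32 (`hEmb`).
[cite: NovacoskiSpivakovsky2014, Thm. 1.2 and Cor. 2.17] [cite: CossartPiltant2019, Thm. 1.1] [cite: CossartJannsenSaito2020, Cor. 1.5] -/
theorem weakEmbeddedLU_residueSide_dimLEFour (hCP : CossartPiltant2019.{0})
    (hEmb : ∀ (Z : Scheme.{0}) [IsIntegral Z] [IsNoetherian Z], Scheme.IsRegular Z →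
      Scheme.IsExcellent Z → ∀ (X : Set Z), IsClosed X → X ≠ Set.univ → topologicalKrullDim X ≤ 2 →
        ∃ (Z' : Scheme.{0}) (π : Z' ⟶ Z), IsProper π ∧ Function.Surjective π.base ∧
          (∃ U : Z.Opens, (U : Set Z) = Xᶜ ∧ IsIso (π ∣_ U)) ∧
          IsStrictNormalCrossingsDivisor Z' (π.base ⁻¹' X))
    (O O₁ : ValuationSubring K) (hO : O ≤ O₁) (hO₁ : O₁ ≠ ⊤)
    (A : Subalgebra k K) (hA : A.toSubring ≤ O.toSubring) (hAfg : A.FG) [IsFractionRing A K]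
    (hdimA : ringKrullDim A ≤ 4)
    (κ : Type) [Field κ] [Algebra k κ] (ι : κ →+* ResidueField O₁) (φ : A →ₐ[k] κ)
    (hφ : ∀ a : A, ι (φ a) = residue O₁ ⟨(a : K), (hA.trans hO) a.2⟩) (hfr : IsFractionRing φ.range κ)
    (W : Finset κ) (hW : ∀ w ∈ W, w ∈ φ.range) :
    ∃ (B : Subalgebra k κ), B.toSubring ≤ ((residueValuationSubring O O₁ hO).comap ι).toSubring ∧ φ.range ≤ B ∧ B.FG ∧
    ∃ (_ : IsRegularLocalRing (locAtCentre B.toSubring ((residueValuationSubring O O₁ hO).comap ι))) (e : ℕ)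
      (a : Fin e → ↥(locAtCentre B.toSubring ((residueValuationSubring O O₁ hO).comap ι))),
      Ideal.span (Set.range a) = IsLocalRing.maximalIdeal ↥(locAtCentre B.toSubring ((residueValuationSubring O O₁ hO).comap ι)) ∧
      ringKrullDim ↥(locAtCentre B.toSubring ((residueValuationSubring O O₁ hO).comap ι)) = (e : WithBot ℕ∞) ∧
      ∀ w ∈ W, w ≠ 0 → ∃ (v : ↥(locAtCentre B.toSubring ((residueValuationSubring O O₁ hO).comap ι))) (μ : Fin e → ℕ), IsUnit v ∧
        w = (v : κ) * ∏ i, ((a i : ↥(locAtCentre B.toSubring ((residueValuationSubring O O₁ hO).comap ι))) : κ) ^ (μ i) := by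
  classical
  haveI : Algebra.FiniteType k A := A.fg_iff_finiteType.mp hAfg
  haveI := hfr
  set O₂' := (residueValuationSubring O O₁ hO).comap ι with hO₂'def
  -- the residue model `φ(A)` lies in the valuation ring of `ν₂` (residues of elements of `O`)
  have hRO₂ : φ.range.toSubring ≤ O₂'.toSubring := by
    rintro x ⟨a, rfl⟩
    change ι (φ a) ∈ residueValuationSubring O O₁ hO
    rw [hφ a]
    exact (residue_mem_residueValuationSubring_iff O O₁ hO _).mpr (hA a.2)
  -- it is finitely generated
  have hRfg : φ.range.FG := by
    rw [← Algebra.map_top]; exact (Algebra.FiniteType.out (R := k) (A := A)).map φ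
  -- and of dimension `≤ 3`: `trdeg_k κ < trdeg_k K = dim A ≤ 4`
  obtain ⟨n, hn, htr⟩ := exists_ringKrullDim_eq_and_trdeg_eq k A
  have hn4 : n ≤ 4 := by rw [hn] at hdimA; exact_mod_cast hdimA
  have hK : Algebra.trdeg k K = n := by rw [trdeg_eq_trdeg_of_isFractionRing A, htr]
  have hlt : Algebra.trdeg k κ < (n : Cardinal) := trdeg_residueField_lt O₁ hO₁ A (hA.trans hO) hAfg hK κ ι φ hφ hfr
  obtain ⟨m, hm⟩ := Cardinal.lt_aleph0.mp (hlt.trans (Cardinal.natCast_lt_aleph0 (n := n)))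
  have hm3 : Algebra.trdeg k κ ≤ 3 := by
    rw [hm] at hlt ⊢
    have : m < n := by exact_mod_cast hlt
    have : m ≤ 3 := by omega
    exact_mod_cast this
  have hdimR : ringKrullDim φ.range ≤ 3 := by exact_mod_cast ringKrullDim_le_of_fg_of_trdeg_le φ.range hRfg hm3
  -- weak embedded LU in dimension `≤ 3` from the (possibly singular) model `φ(A)` along `ν₂`
  exact weakEmbeddedLU_dimLEThree_of_cossartPiltant2019 hCP hEmb k κ O₂' φ.range hRO₂ hRfg hfr hdimR W hW

end Summit.ResolutionOfSingularities.ResolutionOfSingularities.Theorems.RadicialJung.CleanModels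

end
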